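import Summits.ResolutionOfSingularities.ResolutionOfSingularities.Theorems.RadicialJungCleanModelsGiraudTotalColengthChart
import Summits.ResolutionOfSingularities.ResolutionOfSingularities.Theorems.RadicialJungCleanModelsWeightedColengthAtPoint
import Summits.ResolutionOfSingularities.ResolutionOfSingularities.Theorems.ValuativeLuAlphaPTorsorColengthDrop
import HarnessLib

/-!
# Route `RadicialJung`, crux `CleanModels` (stmt-15917): Giraud's Lemme 2.1.1 at a single point
# of the exceptional curve

Support file (OURS) for PROGRAMME-clean-dim2 (K2/K4, W8.1). For a two-dimensional regular local
ring `(R, 𝔪 = (x, y)) ⊆ K`, an `𝔪`-primary ideal `J` of order `r` (`J ⊆ 𝔪ʳ`, `J ⊄ 𝔪ʳ⁺¹`, `R/J`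
of finite length), the chart `A = R[y/x]` of the blowing up of the closed point with weak transform
`Jᴬ = (JA : xʳ)`, and a closed point `ξ′` of the chart below `V(Jᴬ)`, i.e. a maximal ideal
`Q ⊇ Jᴬ` of `A` with local ring `T = A_Q`:

`[κ(ξ′) : κ(ξ)] · λ(T/JᴬT) + r(r+1)/2 ≤ λ(R/J)`,

Giraud's `[k(ξ′):k(ξ)]·c(I′,ξ′) ≤ c(I,ξ) − m(m+1)/2` (Bull. SMF 111 (1983), Lemme 2.1.1) read for
ONE point (the full weighted sum over ALL points of the exceptional curve is
`length_quot_weakTransform_charts_add_le`, `RadicialJungCleanModelsGiraudTotalColength.lean`).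
Every point of the exceptional curve lies in the chart of `x` or in that of `y`, so this covers
every point. Ingredients: the ONE-chart weighted bound `λ_R(𝔪ʳ𝒜/J𝒜) + λ_R(R/𝔪ʳ) ≤ λ_R(R/J)`
(`xʳA ⊆ JA + ι(𝔪ʳ)` without genericity hypothesis — Kodiyalam's division by the initial form,
`PfaffLine.exists_pow_mul_sub_mem_map`), the identification `λ_R(A/Jᴬ) = λ_R(𝔪ʳ𝒜/J𝒜)`
(multiplication by `xʳ`), and one term of Fulton's formula
(`length_quotient_mul_length_atPrime_le`).

* `length_quot_weakTransform_chart_add_le` — the one-chart weighted bound;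
* `length_restrictScalars_quotient_weakTransformChart_eq` — `λ_R(A/Jᴬ) = λ_R(𝔪ʳ𝒜/J𝒜)` for any
  `R`-algebra structure on `A` with structure map the inclusion;
* `length_quotient_mul_length_atPrime_weakTransform_le` — **the point bound** above.

References: J. Giraud, Bull. SMF 111 (1983), Lemme 2.1.1 [Giraud1983]; V. Kodiyalam, Trans. AMS
347 (1995), Thm. 4.5; C. Huneke, I. Swanson (2006), Lemma 14.3.4 [HunekeSwanson2006]. Nothing here
is a statement of Hironaka's manuscript or bears on the summit directly.
-/

noncomputable section

set_option linter.dupNamespace false -- mandated namespace of this single-conjunct summit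

open IsLocalRing Literature.AlgebraicGeometry.Resolution
open Summit.ResolutionOfSingularities.ResolutionOfSingularities.Theorems.PfaffLine

namespace Summit.ResolutionOfSingularities.ResolutionOfSingularities.Theorems.RadicialJung.CleanModels

universe u

variable {K : Type u} [Field K] {R : Subring K} [IsRegularLocalRing R] {x y : R}

/-- **One-chart weighted form of Giraud 2.1.1 / Huneke–Swanson 14.3.4 without genericity**: for
`J ⊆ 𝔪ʳ`, `J ⊄ 𝔪ʳ⁺¹`, `R/J` of finite length and `𝒜 = R[y/x]`:
`λ_R(𝔪ʳ𝒜/J𝒜) + λ_R(R/𝔪ʳ) ≤ λ_R(R/J)` — `𝔪ʳ𝒜/J𝒜 = xʳA/JA` is an `R`-quotient of `𝔪ʳ/J` since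
`xʳA ⊆ JA + ι(𝔪ʳ)` (`PfaffLine.exists_pow_mul_sub_mem_map`). [cite: Giraud1983, Lemme 2.1.1] -/
theorem length_quot_weakTransform_chart_add_le (hdim : ringKrullDim R = 2)
    (hm : maximalIdeal R = Ideal.span {x, y}) {J : Ideal R} {r : ℕ}
    (hJ : J ≤ maximalIdeal R ^ r) (hJr : ¬ J ≤ maximalIdeal R ^ (r + 1))
    (hfin : IsFiniteLength R (R ⧸ J)) {𝒜 : Submodule R K}
    (h𝒜 : 𝒜 = Subalgebra.toSubmodule (Algebra.adjoin R {((y : R) : K) / ((x : R) : K)})) :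
    Module.length R (↥(maximalIdeal R ^ r • 𝒜) ⧸ (J • 𝒜).comap (maximalIdeal R ^ r • 𝒜).subtype) +
      Module.length R (R ⧸ maximalIdeal R ^ r) ≤ Module.length R (R ⧸ J) := by
  subst h𝒜
  set 𝒜 := Subalgebra.toSubmodule (Algebra.adjoin R {((y : R) : K) / ((x : R) : K)}) with h𝒜
  have hx0 : x ≠ 0 := fun h => fst_not_mem_sq hdim hm (by rw [h]; exact Ideal.zero_mem _)
  have h1 : (1 : K) ∈ 𝒜 := Subalgebra.one_mem _
  -- `δ : 𝔪ʳ → 𝔪ʳ𝒜/J𝒜`, `m ↦ m`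
  have hmemN : ∀ m : ↥(maximalIdeal R ^ r), ((m : R) : K) ∈ maximalIdeal R ^ r • 𝒜 := fun m => by
    rw [show ((m : R) : K) = (m : R) • (1 : K) by rw [Algebra.smul_def, mul_one]; rfl]
    exact Submodule.smul_mem_smul m.2 h1
  let δ : ↥(maximalIdeal R ^ r) →ₗ[R]
      ↥(maximalIdeal R ^ r • 𝒜) ⧸ (J • 𝒜).comap (maximalIdeal R ^ r • 𝒜).subtype :=
    { toFun := fun m => Submodule.Quotient.mk ⟨((m : R) : K), hmemN m⟩
      map_add' := fun m m' => by
        rw [← Submodule.Quotient.mk_add]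
        rfl
      map_smul' := fun c m => by
        rw [RingHom.id_apply, ← Submodule.Quotient.mk_smul]
        congr 1 }
  have hδ : ∀ m, δ m = Submodule.Quotient.mk ⟨((m : R) : K), hmemN m⟩ := fun m => rfl
  -- surjective, by Kodiyalam's `xʳA ⊆ JA + ι(𝔪ʳ)`
  have hδs : Function.Surjective δ := by
    intro q
    induction q using Submodule.Quotient.induction_on with
    | H z =>
      obtain ⟨w, hw⟩ := z
      have hw' := hw
      rw [maximalIdeal_pow_smul_toSubmodule_adjoin hm hx0, mem_span_singleton_smul_toSubmodule_iff]
        at hw'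
      obtain ⟨a, ha, hwa⟩ := hw'
      obtain ⟨m, hm', hma⟩ := exists_pow_mul_sub_mem_map (K := K) hdim hm hx0 hJ hJr hfin ⟨a, ha⟩
      refine ⟨⟨m, hm'⟩, ?_⟩
      rw [hδ, Submodule.Quotient.eq, Submodule.mem_comap, Submodule.subtype_apply,
        Submodule.coe_sub]
      change ((m : R) : K) - w ∈ J • 𝒜
      have hwa' : w = ((chartIncl x y x ^ r * ⟨a, ha⟩ : chartAdjoin (K := K) x y) : K) := by
        rw [← hwa]; simp
      have hmem : ((chartIncl x y x ^ r * ⟨a, ha⟩ - chartIncl x y m : chartAdjoin (K := K) x y) : K) ∈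
          J • 𝒜 := (mem_map_chartIncl_iff_mem_smul J _).mp (by
        convert hma using 1)
      have e : ((m : R) : K) - w =
          -(((chartIncl x y x ^ r * ⟨a, ha⟩ - chartIncl x y m : chartAdjoin (K := K) x y)) : K) := by
        rw [hwa']
        simp
      rw [e]
      exact neg_mem hmem
  -- kernel contains `J`
  have hker : Submodule.comap (Submodule.subtype (maximalIdeal R ^ r)) J ≤ LinearMap.ker δ := by
    intro m hm'
    rw [Submodule.mem_comap, Submodule.subtype_apply] at hm'
    rw [LinearMap.mem_ker, hδ, Submodule.Quotient.mk_eq_zero, Submodule.mem_comap,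
      Submodule.subtype_apply]
    exact map_linearMap_le_smul_toSubmodule J _ ⟨(m : R), hm', rfl⟩
  have h2 := length_quot_comap_add_length_quotient (R := R) (V := R) hJ
  calc _ ≤ Module.length R (↥(maximalIdeal R ^ r) ⧸
          Submodule.comap (Submodule.subtype (maximalIdeal R ^ r)) J) +
        Module.length R (R ⧸ maximalIdeal R ^ r) := by
          gcongr
          calc _ = Module.length R (↥(maximalIdeal R ^ r) ⧸ LinearMap.ker δ) :=
                ((LinearMap.quotKerEquivRange δ).trans
                  (LinearEquiv.ofTop _ (LinearMap.range_eq_top.mpr hδs))).length_eq.symm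
            _ ≤ _ := Module.length_le_of_surjective (Submodule.factor hker)
                (Submodule.factor_surjective hker)
    _ = _ := h2

section AlgebraInstance

variable [IsLocalRing R]

omit [IsRegularLocalRing R] in
/-- **`λ_R(A/Jᴬ) = λ_R(𝔪ʳ𝒜/J𝒜)`**: for any `R`-algebra structure on the chart `A = R[y/x]` whose
structure map is the inclusion, the `R`-length of `A/Jᴬ` (`Jᴬ = (JA : xʳ)`) is the `R`-length of
`𝔪ʳ𝒜/J𝒜 = xʳA/JA` (multiplication by `xʳ`; cf. `length_quotient_weakTransformChart_le`).
[cite: Giraud1983, Lemme 2.1.1] -/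
theorem length_restrictScalars_quotient_weakTransformChart_eq
    (hm : maximalIdeal R = Ideal.span {x, y}) (hx0 : x ≠ 0) (J : Ideal R) (r : ℕ)
    [Algebra R (chartAdjoin (K := K) x y)]
    (halg : algebraMap R (chartAdjoin (K := K) x y) = chartIncl x y) {𝒜 : Submodule R K}
    (h𝒜 : 𝒜 = Subalgebra.toSubmodule (Algebra.adjoin R {((y : R) : K) / ((x : R) : K)})) :
    Module.length R (chartAdjoin (K := K) x y ⧸ weakTransformChart x y J r) =
      Module.length R
        (↥(maximalIdeal R ^ r • 𝒜) ⧸ (J • 𝒜).comap (maximalIdeal R ^ r • 𝒜).subtype) := by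
  subst h𝒜
  set 𝒜 := Subalgebra.toSubmodule (Algebra.adjoin R {((y : R) : K) / ((x : R) : K)}) with h𝒜
  set x' : chartAdjoin (K := K) x y := chartIncl x y x with hx'
  set JS : Ideal (chartAdjoin (K := K) x y) := J.map (chartIncl x y) with hJS
  -- `σ : A → A/JA`, `s ↦ xʳ s`, with kernel `Jᴬ`
  let σ : chartAdjoin (K := K) x y →ₗ[chartAdjoin (K := K) x y] chartAdjoin (K := K) x y ⧸ JS :=
    (Submodule.mkQ JS).comp (LinearMap.mulLeft _ (x' ^ r))
  have hσ : ∀ s, σ s = Submodule.Quotient.mk (x' ^ r * s) := fun s => rfl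
  have hkerσ : LinearMap.ker σ = weakTransformChart x y J r := by
    ext s
    rw [LinearMap.mem_ker, hσ, Submodule.Quotient.mk_eq_zero, Submodule.mem_colon_singleton,
      smul_eq_mul, mul_comm]
  -- `Φ : 𝔪ʳ𝒜 → A/JA`, `z ↦ z`
  have hle : maximalIdeal R ^ r • 𝒜 ≤ 𝒜 := Submodule.smul_le_right
  have halgK : ∀ c : R, ((algebraMap R (chartAdjoin (K := K) x y) c :
      chartAdjoin (K := K) x y) : K) = ((c : R) : K) := fun c => by rw [halg]; rfl
  let Φ : ↥(maximalIdeal R ^ r • 𝒜) →ₗ[R] chartAdjoin (K := K) x y ⧸ JS :=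
    { toFun := fun z => Submodule.Quotient.mk ⟨(z : K), hle z.2⟩
      map_add' := fun z z' => by
        rw [← Submodule.Quotient.mk_add]
        rfl
      map_smul' := fun c z => by
        rw [RingHom.id_apply, ← Submodule.Quotient.mk_smul]
        congr 1
        apply Subtype.ext
        simp [Algebra.smul_def, Algebra.algebraMap_ofSubsemiring_apply, halgK] }
  have hΦ : ∀ z, Φ z = Submodule.Quotient.mk ⟨(z : K), hle z.2⟩ := fun z => rfl
  have hkerΦ : LinearMap.ker Φ = (J • 𝒜).comap (maximalIdeal R ^ r • 𝒜).subtype := by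
    ext z
    rw [LinearMap.mem_ker, hΦ, Submodule.Quotient.mk_eq_zero, hJS, mem_map_chartIncl_iff_mem_smul,
      Submodule.mem_comap, Submodule.subtype_apply]
  have hrange : (LinearMap.range σ).restrictScalars R = LinearMap.range Φ := by
    ext q
    rw [Submodule.restrictScalars_mem, LinearMap.mem_range, LinearMap.mem_range]
    constructor
    · rintro ⟨s, rfl⟩
      have hmem : ((x : R) : K) ^ r * (s : K) ∈ maximalIdeal R ^ r • 𝒜 := by
        rw [maximalIdeal_pow_smul_toSubmodule_adjoin hm hx0,
          mem_span_singleton_smul_toSubmodule_iff]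
        exact ⟨s, s.2, by rw [Subring.coe_pow]⟩
      refine ⟨⟨_, hmem⟩, ?_⟩
      exact (hΦ _).trans ((congrArg Submodule.Quotient.mk
        (Subtype.ext (by simp [hx']))).trans (hσ s).symm)
    · rintro ⟨⟨w, hw⟩, rfl⟩
      have hw' := hw
      rw [maximalIdeal_pow_smul_toSubmodule_adjoin hm hx0,
        mem_span_singleton_smul_toSubmodule_iff] at hw'
      obtain ⟨a, ha, hwa⟩ := hw'
      rw [Subring.coe_pow] at hwa
      refine ⟨⟨a, ha⟩, ?_⟩
      exact (hσ _).trans ((congrArg Submodule.Quotient.mk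
        (Subtype.ext (by simpa [hx'] using hwa))).trans (hΦ _).symm)
  -- the `R`-linear identifications
  let e₁ : (chartAdjoin (K := K) x y ⧸ weakTransformChart x y J r) ≃ₗ[R]
      ↥(LinearMap.range σ) :=
    ((Submodule.quotEquivOfEq _ _ hkerσ.symm).trans (LinearMap.quotKerEquivRange σ)).restrictScalars R
  let e₂ : ↥(LinearMap.range σ) ≃ₗ[R] ↥((LinearMap.range σ).restrictScalars R) :=
    { AddEquiv.refl _ with map_smul' := fun _ _ => rfl }
  calc Module.length R (chartAdjoin (K := K) x y ⧸ weakTransformChart x y J r)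
      = Module.length R ↥((LinearMap.range σ).restrictScalars R) := (e₁.trans e₂).length_eq
    _ = Module.length R (LinearMap.range Φ) := by rw [hrange]
    _ = Module.length R (↥(maximalIdeal R ^ r • 𝒜) ⧸ LinearMap.ker Φ) :=
        (LinearMap.quotKerEquivRange Φ).length_eq.symm
    _ = _ := by rw [hkerΦ]

end AlgebraInstance

/-- **Giraud's Lemme 2.1.1 at one point of the exceptional curve.** Let `(R, 𝔪 = (x, y)) ⊆ K` be
a two-dimensional regular local ring, `J ⊆ 𝔪ʳ`, `J ⊄ 𝔪ʳ⁺¹` an ideal with `R/J` of finite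
length, `A = R[y/x]` the chart of the blowing up of the closed point (with any `R`-algebra
structure whose structure map is the inclusion), `Jᴬ = (JA : xʳ)` the weak transform, `Q ⊇ Jᴬ` a
maximal ideal of `A` (a closed point `ξ′` of the exceptional curve in this chart lying on `V(Jᴬ)`)
and `T = A_Q = 𝒪_{X′,ξ′}`. Then
`λ_R(A/Q) · λ_T(T/JᴬT) + λ_R(R/𝔪ʳ) ≤ λ_R(R/J)`, i.e. with `λ_R(A/Q) = [κ(ξ′):κ(ξ)]`,
`λ_R(R/𝔪ʳ) = r(r+1)/2` (`length_quotient_pow_maximalIdeal_eq`) and `c = λ`: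
`[κ(ξ′):κ(ξ)] · c(J′, ξ′) ≤ c(J, ξ) − r(r+1)/2` (Giraud 1983, Lemme 2.1.1, one term of the sum;
points of the other chart by symmetry `x ↔ y`). [cite: Giraud1983, Lemme 2.1.1] -/
theorem length_quotient_mul_length_atPrime_weakTransform_add_le (hdim : ringKrullDim R = 2)
    (hm : maximalIdeal R = Ideal.span {x, y}) {J : Ideal R} {r : ℕ}
    (hJ : J ≤ maximalIdeal R ^ r) (hJr : ¬ J ≤ maximalIdeal R ^ (r + 1))
    (hfin : IsFiniteLength R (R ⧸ J)) [Algebra R (chartAdjoin (K := K) x y)]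
    (halg : algebraMap R (chartAdjoin (K := K) x y) = chartIncl x y)
    (Q : Ideal (chartAdjoin (K := K) x y)) [Q.IsMaximal] (hWQ : weakTransformChart x y J r ≤ Q)
    (T : Type u) [CommRing T] [Algebra (chartAdjoin (K := K) x y) T] [IsLocalization.AtPrime T Q] :
    Module.length R (chartAdjoin (K := K) x y ⧸ Q) *
        Module.length T (T ⧸ (weakTransformChart x y J r).map
          (algebraMap (chartAdjoin (K := K) x y) T)) +
      Module.length R (R ⧸ maximalIdeal R ^ r) ≤ Module.length R (R ⧸ J) := by
  have hx0 : x ≠ 0 := fun h => fst_not_mem_sq hdim hm (by rw [h]; exact Ideal.zero_mem _)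
  have h1 := length_quot_weakTransform_chart_add_le (K := K) hdim hm hJ hJr hfin rfl
  have h2 := length_restrictScalars_quotient_weakTransformChart_eq (K := K) hm hx0 J r halg rfl
  -- `A/Jᴬ` has finite length over `A`
  have hfinA : IsFiniteLength (chartAdjoin (K := K) x y)
      (chartAdjoin (K := K) x y ⧸ weakTransformChart x y J r) := by
    rw [← Module.length_ne_top_iff]
    have h3 := length_quotient_weakTransformChart_le (K := K) hm hx0 J r
      (𝒜 := Subalgebra.toSubmodule (Algebra.adjoin R {((y : R) : K) / ((x : R) : K)})) rfl
    have h4 : Module.length R (R ⧸ J) ≠ ⊤ := Module.length_ne_top_iff.mpr hfin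
    intro htop
    rw [htop, top_le_iff] at h3
    rw [h3, top_add, top_le_iff] at h1
    exact h4 h1
  have h5 := length_quotient_mul_length_atPrime_le (R := R) (weakTransformChart x y J r) Q hWQ
    hfinA T
  rw [h2] at h5
  exact (add_le_add h5 le_rfl).trans h1

/-- The same with `λ_R(R/𝔪ʳ) = r(r+1)/2` made explicit:
`[κ(ξ′):κ(ξ)] · λ(𝒪_{X′,ξ′}/J′) + r(r+1)/2 ≤ λ(R/J)`. [cite: Giraud1983, Lemme 2.1.1] -/
theorem length_quotient_mul_length_atPrime_weakTransform_add_choose_le (hdim : ringKrullDim R = 2)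
    (hm : maximalIdeal R = Ideal.span {x, y}) {J : Ideal R} {r : ℕ}
    (hJ : J ≤ maximalIdeal R ^ r) (hJr : ¬ J ≤ maximalIdeal R ^ (r + 1))
    (hfin : IsFiniteLength R (R ⧸ J)) [Algebra R (chartAdjoin (K := K) x y)]
    (halg : algebraMap R (chartAdjoin (K := K) x y) = chartIncl x y)
    (Q : Ideal (chartAdjoin (K := K) x y)) [Q.IsMaximal] (hWQ : weakTransformChart x y J r ≤ Q)
    (T : Type u) [CommRing T] [Algebra (chartAdjoin (K := K) x y) T] [IsLocalization.AtPrime T Q] :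
    Module.length R (chartAdjoin (K := K) x y ⧸ Q) *
        Module.length T (T ⧸ (weakTransformChart x y J r).map
          (algebraMap (chartAdjoin (K := K) x y) T)) +
      ((r * (r + 1) / 2 : ℕ) : ℕ∞) ≤ Module.length R (R ⧸ J) := by
  rw [← length_quotient_pow_maximalIdeal_eq hdim r]
  exact length_quotient_mul_length_atPrime_weakTransform_add_le hdim hm hJ hJr hfin halg Q hWQ T

end Summit.ResolutionOfSingularities.ResolutionOfSingularities.Theorems.RadicialJung.CleanModels

end
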